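import Literature.NumberTheory.LFunctions.WeilTwoPrimeOddMarginHBase
import Literature.NumberTheory.LFunctions.WeilTwoPrimeOddMarginHDataP22
import Literature.NumberTheory.LFunctions.WeilBlockRowsP
import HarnessLib

/-!
# Two-prime odd-margin certificate H: the materialized block agrees with `P_r`, rows 20–29

`WeilCert.checkPmRow` (row `k` of the claim `Pm_{kl} = P_r(2k+1, 2l+1)`) for certificate H, by `decide +kernel`. Pure proof file; nothing is asserted.
-/

noncomputable section

namespace Literature.NumberTheory.LFunctions

set_option maxHeartbeats 0 in
/-- Row 20 of the materialized block is row 20 of `P_r` (certificate H). [folklore] -/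
theorem checkPmRow1_20_weilCert23H : weilCert23HBase.checkPmRow weilCert23HNu weilCert23HPm 1 20 = true := by
  decide +kernel

set_option maxHeartbeats 0 in
/-- Row 21 of the materialized block is row 21 of `P_r` (certificate H). [folklore] -/
theorem checkPmRow1_21_weilCert23H : weilCert23HBase.checkPmRow weilCert23HNu weilCert23HPm 1 21 = true := by
  decide +kernel

set_option maxHeartbeats 0 in
/-- Row 22 of the materialized block is row 22 of `P_r` (certificate H). [folklore] -/
theorem checkPmRow1_22_weilCert23H : weilCert23HBase.checkPmRow weilCert23HNu weilCert23HPm 1 22 = true := by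
  decide +kernel

set_option maxHeartbeats 0 in
/-- Row 23 of the materialized block is row 23 of `P_r` (certificate H). [folklore] -/
theorem checkPmRow1_23_weilCert23H : weilCert23HBase.checkPmRow weilCert23HNu weilCert23HPm 1 23 = true := by
  decide +kernel

set_option maxHeartbeats 0 in
/-- Row 24 of the materialized block is row 24 of `P_r` (certificate H). [folklore] -/
theorem checkPmRow1_24_weilCert23H : weilCert23HBase.checkPmRow weilCert23HNu weilCert23HPm 1 24 = true := by
  decide +kernel

set_option maxHeartbeats 0 in
/-- Row 25 of the materialized block is row 25 of `P_r` (certificate H). [folklore] -/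
theorem checkPmRow1_25_weilCert23H : weilCert23HBase.checkPmRow weilCert23HNu weilCert23HPm 1 25 = true := by
  decide +kernel

set_option maxHeartbeats 0 in
/-- Row 26 of the materialized block is row 26 of `P_r` (certificate H). [folklore] -/
theorem checkPmRow1_26_weilCert23H : weilCert23HBase.checkPmRow weilCert23HNu weilCert23HPm 1 26 = true := by
  decide +kernel

set_option maxHeartbeats 0 in
/-- Row 27 of the materialized block is row 27 of `P_r` (certificate H). [folklore] -/
theorem checkPmRow1_27_weilCert23H : weilCert23HBase.checkPmRow weilCert23HNu weilCert23HPm 1 27 = true := by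
  decide +kernel

set_option maxHeartbeats 0 in
/-- Row 28 of the materialized block is row 28 of `P_r` (certificate H). [folklore] -/
theorem checkPmRow1_28_weilCert23H : weilCert23HBase.checkPmRow weilCert23HNu weilCert23HPm 1 28 = true := by
  decide +kernel

set_option maxHeartbeats 0 in
/-- Row 29 of the materialized block is row 29 of `P_r` (certificate H). [folklore] -/
theorem checkPmRow1_29_weilCert23H : weilCert23HBase.checkPmRow weilCert23HNu weilCert23HPm 1 29 = true := by
  decide +kernel


end Literature.NumberTheory.LFunctions
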